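import Summits.HodgeConjecture.HodgeConjecture.Theorems.F0LD1ThetaGermDefs
import Summits.HodgeConjecture.HodgeConjecture.Theorems.F0LD1ArchTorusHom
import Summits.HodgeConjecture.HodgeConjecture.Theorems.F0LD2ThetaTensorClasses
import Summits.HodgeConjecture.HodgeConjecture.Theorems.F0LD2FrameTransportPin
import HarnessLib

/-!
# Crux `HLiu418`, line LD1 — THE THREE (Gα) BRICKS `SliceCyclic`, `ArchLadder`, `FinGeneration` (STATEMENTS ONLY; organ definitions, prose locators)

Cell hodgecm-mathlib, FLOOR 0, programme-6 line LD1 (socket `stub_S1_facts`, #73 E1θhol; leaf `Cruxes/HLiu418/Lines/F0_P6LD_StubS1FactsThetaRoad.lean`,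
organ `stub_organ_thetaDichotomy` = ★ `F0LD1ThetaGermDefs.ThetaDichotomy₂`).  LD1-plan (g2) junction texts; namespace
`Summit.HodgeConjecture.HodgeConjecture.Cruxes.HLiu418.F0LD1ThetaDichotomyOfBricks` (shared with the proofs module
`Theorems/F0LD1ThetaDichotomyOfBricks.lean`, which imports this one — the split mirrors ★ `F0LD1ThetaSliceBricks` ∕ `F0LD1ThetaSliceOfBricks` and the
gate's 400-line rule for Theorems files with proofs).  DEFINITIONS ONLY: three `def … : Prop`, every binder prefix LITERALLY that of ★
`F0LD1ThetaGermDefs.ThetaSlice₂` (continuity ∕ rationality of the pinned transport and compactness of `[U(H)]` derived in-body by `haveI`, as in ★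
`F0LD1ThetaSliceBricks`); no theorem, no instance, no notation, no `sorry`; organ definitions carry PROSE locators only (★ `F0LD1ThetaGermDefs` convention).

* (Gα-C) `SliceCyclic` — a non-zero Hermite-slice theta class `[θ^{μ_W}_{h_β ⊗ Φ_f}]` lying in a closed `R`-invariant `Q ⊆ L²([U(H)])` drags EVERY
  `(a′, ξ)`-theta class into `Q`.  With the four (Gβ) bricks it gives (Gα) (`thetaDichotomy₂_of_bricks` in the proofs module).
* (Gα-C∞) `ArchLadder` — archimedean generation through `Q`: then every Hermite-slice class `[θ^{μ_W}_{h_β′ ⊗ Φ_f}]` lies in `Q` (≡ irreducibility of the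
  `ξ_∞`-isotypic part of the archimedean Weil representation under `U(V)_∞`; Kashiwara–Vergne 1978 §6, Howe 1989 §3, Folland 1989 Thm. 4.37).
* (Gα-Cf) `FinGeneration` — finite-adelic generation through `Q`: `[θ_{φ ⊗ Φ_f}] ∈ Q` forces `[θ_{φ ⊗ Φ_f′}] ∈ Q` for all `Φ_f′` (≡ irreducibility of the
  finite big theta `Θ_f(ξ_f)`; Moeglin–Vignéras–Waldspurger 1987 Chap. 3 IV.4 at non-split places — ★ `mvw_IV4_rankOne_irreducibleOrZero_holds` —,
  the unitary principal series of `GL₂` at split places, restricted tensor products after Flath 1979 Thm. 2).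

`SliceCyclic ⇐ HermiteSum → MeasureScaling → ArchLadder → FinGeneration` and `ThetaDichotomy₂ ⇐` the six bricks are PROVED in the proofs module.
HONEST LABEL: HC_CM is proved only modulo the 7 printed citations (2 remaining: hLiu418 = stmt-HodgeConjecture-24832, h413 =
stmt-HodgeConjecture-24833) until rung 0 closes; this file discharges nothing printed by itself; count-neutral.
-/
set_option autoImplicit false
set_option linter.dupNamespace false

noncomputable section

open NumberField NumberField.InfinitePlace MeasureTheory IsDedekindDomain
open scoped Matrix Kronecker ComplexOrder ENNReal TensorProduct SchwartzMap InnerProductSpace ComplexConjugate Classical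
open Literature.NumberTheory.Automorphic Literature.NumberTheory.Automorphic.UnitaryGroup
open Literature.NumberTheory.Automorphic.UnitaryGroup.CotangentForms (toQuotFun)
open Literature.NumberTheory.Automorphic.UnitaryCurveForms
open Literature.NumberTheory.Automorphic.Liu2021 Literature.NumberTheory.Automorphic.Liu2021.Def411WeilCarriers
open Literature.NumberTheory.Automorphic.Liu2021.Def411WeilCarriersDoubling
open Literature.NumberTheory.Automorphic.Liu2021.CinfThetaTorus
open Literature.NumberTheory.GaloisRepresentations Literature.NumberTheory.Automorphic.IdeleClassGroup
open Literature.NumberTheory.GelbartRogawski1991 Literature.NumberTheory.GelbartRogawski1991.UnitaryDualPair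
open Literature.NumberTheory.GelbartRogawski1991.UnitaryDualPair.WeilCoinv
open Literature.NumberTheory.GelbartRogawski1991.GRConstruction
open Literature.NumberTheory.Weil1964
open Literature.RepresentationTheory.Liu2021 Literature.RepresentationTheory.HarrisKudlaSweet1996
open Literature.RepresentationTheory.HeisenbergGroup Literature.Analysis.SegalBargmann
open Literature.RepresentationTheory.KonnoKonno2007 Literature.RepresentationTheory.KonnoKonno2007.RealDualPair
open Literature.RepresentationTheory.CompactGroups
open Literature.NumberTheory.Rogawski1990
open Summit.HodgeConjecture.HodgeConjecture.Cruxes.HLiu418.F0LD1ThetaTransportKit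
open Summit.HodgeConjecture.HodgeConjecture.Cruxes.HLiu418.F0LD2ThetaTensorClasses
open Summit.HodgeConjecture.HodgeConjecture.Cruxes.HLiu418.F0LD2FrameTransportPin
open Summit.HodgeConjecture.HodgeConjecture.Cruxes.HLiu418.F0LD1ThetaGermDefs

namespace Summit.HodgeConjecture.HodgeConjecture.Cruxes.HLiu418.F0LD1ThetaDichotomyOfBricks

open F0LD1ThetaGermDefs

/-! ## §1 (Gα-C) `SliceCyclic` -/

/-- **(Gα-C) `SliceCyclic`** — over LITERALLY the `ThetaSlice₂` frames: a NON-ZERO Hermite-slice theta class `w = [θ^{μ_W}_{h_β ⊗ Φ_f}]` lying in a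
closed `R`-invariant subspace `Q ⊆ L²([U(H)])` forces EVERY `(a′, ξ)`-theta class (any datum `(hρ′, μ_W′)`, any `Ψ`) into `Q`.  Content (LOCAL, place by
place; no multiplicity one, no spectral decomposition): `R(γ) w = [θ_{ω(ιA γ)(h_β ⊗ Φ_f)}]` (★ kit) and `ιA` is onto `U(V)(𝔸)` (the pin); `θ(ξ)` kills the
`(U(W)(𝔸), ξ)`-coinvariant kernel (invariance of `μ_W`); FINITE PART: the `U(V)(𝔸_f)`-module of `ξ_f`-coinvariants of `FinSB` is irreducible — every
non-zero vector is cyclic (local Howe duality: non-split ★ `mvw_IV4_rankOne_irreducibleOrZero_holds`, split `(GL₁, GL₂)`; restricted tensor product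
[Flath1979, Thm. 2]); ARCHIMEDEAN PART: the `U(V)_∞`-translates of `h_β` span a dense subspace of the `ξ_∞`-isotypic part of `𝓢` ([KashiwaraVergne1978] at
`ι`, finite-dimensional `Sym^d` at definite places); then ★ `exists_clm_toLp_lineThetaLift_tmul` (continuity in `φ`) and (Gβ-M) (other `μ_W′`).
Why it might fail: at a SPLIT finite place the local big theta `Θ_v(ξ_v)` is a principal series of `GL₂(L⁺_v)` — reducible for the two special
`ξ_v`; the conjugate-symplectic weight-one `ξ` should exclude them (to be checked by the pen).  ORGAN-GRADE (L–XL). (MoeglinVignerasWaldspurger1987, Chap. 3 IV.4)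
(Rallis1984, §1) -/
def SliceCyclic : Prop :=
  ∀ (L : Type) [Field L] [NumberField L] [IsCMField L] (ι : L →+* ℂ) (H : Matrix (Fin 2) (Fin 2) L)
      (dV : Fin 2 → L) (hdV : ∀ i, IsCMField.complexConj L (dV i) = dV i) (hdV0 : ∀ i, dV i ≠ 0)
      (t : L) (ht : t ≠ 0) (g : GL (Fin 2) L)
      (hg : formCongr ((IsCMField.complexConj L : L ≃ₐ[↥(maximalRealSubfield L)] L) : L →+* L) g (t • H) = Matrix.diagonal dV),
      (∃ T : GL (Fin 2) ℂ, formCongr (starRingEnd ℂ) T ((Matrix.diagonal dV).map ι) = Matrix.diagonal ![(1 : ℂ), -1]) →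
      ∀ (hdef : ∀ τ' : L →+* ℂ, InfinitePlace.mk τ' ≠ InfinitePlace.mk ι → ((Matrix.diagonal dV).map τ').PosDef)
        (hdeg : 4 ≤ Module.finrank ℚ L)
        (μ : Measure (adelicGroupData (↥(maximalRealSubfield L)) L (IsCMField.complexConj L) 2 H).automorphicQuotient)
        [(adelicGroupData (↥(maximalRealSubfield L)) L (IsCMField.complexConj L) 2 H).IsAutomorphicMeasure μ]
        {n' : ℕ} (e₁ : Fin 2 × Fin 1 ≃ Fin n')
        (lam : Literature.NumberTheory.Automorphic.IdeleClassGroup L →ₜ* Circle) (hlam : IsConjugateSymplectic L lam), HasWeight L lam 1 →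
      ∀ (ιA : (adelicGroupData (↥(maximalRealSubfield L)) L (IsCMField.complexConj L) 2 H).Adelic →*
          ↥(UnitaryGroup.adelic (↥(maximalRealSubfield L)) L (IsCMField.complexConj L) 2 (Matrix.diagonal dV)))
        (hιA : ∀ k, ((ιA k : ↥(UnitaryGroup.adelic (↥(maximalRealSubfield L)) L (IsCMField.complexConj L) 2 (Matrix.diagonal dV))) :
              GL (Fin 2) (AdeleRing (𝓞 L) L)) =
            (toAdeleGL L g)⁻¹ * adelicVal (↥(maximalRealSubfield L)) L (IsCMField.complexConj L) 2 H k * toAdeleGL L g)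
        [CompactSpace (↥(UnitaryGroup.adelic (↥(maximalRealSubfield L)) L (IsCMField.complexConj L) 2 (Matrix.diagonal dV)) ⧸
          (UnitaryGroup.toAdelic (↥(maximalRealSubfield L)) L (IsCMField.complexConj L) 2 (Matrix.diagonal dV)).range)]
        (a' : (↥(maximalRealSubfield L))ˣ)
        (ξ : haveI := normal_range_toAdelic_JW L a'
          PontryaginDual (↥(UnitaryGroup.adelic (↥(maximalRealSubfield L)) L (IsCMField.complexConj L) 1 (JW (↥(maximalRealSubfield L)) L a')) ⧸ (UnitaryGroup.toAdelic (↥(maximalRealSubfield L)) L (IsCMField.complexConj L) 1 (JW (↥(maximalRealSubfield L)) L a')).range)),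
        letI : MeasurableSpace (↥(UnitaryGroup.adelic (↥(maximalRealSubfield L)) L (IsCMField.complexConj L) 1 (JW (↥(maximalRealSubfield L)) L a')) ⧸ (UnitaryGroup.toAdelic (↥(maximalRealSubfield L)) L (IsCMField.complexConj L) 1 (JW (↥(maximalRealSubfield L)) L a')).range) := borel _
        haveI := normal_range_toAdelic_JW L a'
        haveI : CompactSpace (adelicGroupData (↥(maximalRealSubfield L)) L (IsCMField.complexConj L) 2 H).automorphicQuotient :=
          (UnitaryGroup.exists_infinitePlace_ne L hdeg ι).elim fun τ hτ =>
            UnitaryGroup.compactSpace_adelicGroupData_automorphicQuotient L 2 H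
              (UnitaryGroup.anisotropic_of_formCongr_smul_eq_of_posDef L 2 H dV t ht g hg τ (hdef τ hτ))
        haveI hT : Continuous ιA ∧ ∀ ⦃γ : (adelicGroupData (↥(maximalRealSubfield L)) L (IsCMField.complexConj L) 2 H).Adelic⦄,
            γ ∈ (UnitaryGroup.toAdelic (↥(maximalRealSubfield L)) L (IsCMField.complexConj L) 2 H).range →
              ιA γ ∈ (UnitaryGroup.toAdelic (↥(maximalRealSubfield L)) L (IsCMField.complexConj L) 2 (Matrix.diagonal dV)).range :=
          ⟨continuous_of_pin L 2 H dV g ιA hιA, fun _ hγ => mem_range_toAdelic_of_pin L 2 H dV t ht g hg ιA hιA hγ⟩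
        ∀ (hρ : HasThetaMajorants fun
          (p : ↥(UnitaryGroup.adelic (↥(maximalRealSubfield L)) L (IsCMField.complexConj L) 2 (Matrix.diagonal dV)) × ↥(UnitaryGroup.adelic (↥(maximalRealSubfield L)) L (IsCMField.complexConj L) 1 (JW (↥(maximalRealSubfield L)) L a'))) (Φ : piSchwartzBruhat (↥(maximalRealSubfield L)) (Fin n')) =>
            pairRep (↥(maximalRealSubfield L)) L (IsCMField.complexConj L) 2 1 e₁ (Matrix.diagonal dV) (JW (↥(maximalRealSubfield L)) L a')
              (chiSplittingLine L e₁ dV hdV hdV0 (toHeckeCharacter L lam) (isUnitary_toHeckeCharacter L lam)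
                ((isOscillatorChar_toHeckeCharacter_iff lam).mpr hlam) (TW (↥(maximalRealSubfield L)) a')
                (isUnit_det_TW (↥(maximalRealSubfield L)) a') (JW (↥(maximalRealSubfield L)) L a') (JW_eq (↥(maximalRealSubfield L)) L a'))
              p Φ)
        (μW : Measure (↥(UnitaryGroup.adelic (↥(maximalRealSubfield L)) L (IsCMField.complexConj L) 1 (JW (↥(maximalRealSubfield L)) L a')) ⧸ (UnitaryGroup.toAdelic (↥(maximalRealSubfield L)) L (IsCMField.complexConj L) 1 (JW (↥(maximalRealSubfield L)) L a')).range)) [IsFiniteMeasure μW] [SMulInvariantMeasure ↥(UnitaryGroup.adelic (↥(maximalRealSubfield L)) L (IsCMField.complexConj L) 1 (JW (↥(maximalRealSubfield L)) L a')) (↥(UnitaryGroup.adelic (↥(maximalRealSubfield L)) L (IsCMField.complexConj L) 1 (JW (↥(maximalRealSubfield L)) L a')) ⧸ (UnitaryGroup.toAdelic (↥(maximalRealSubfield L)) L (IsCMField.complexConj L) 1 (JW (↥(maximalRealSubfield L)) L a')).range) μW]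
        (β : ((Fin n' × {v : InfinitePlace (↥(maximalRealSubfield L)) // v.IsReal}) →₀ ℕ)) (Φf : FinSB (↥(maximalRealSubfield L)) (Fin n')),
          MemLp.toLp _ (memLp_toQuotFun_lineThetaLift L 2 H e₁ dV hdV hdV0 ιA hT lam hlam a' hρ μW
            (piSchwartzBruhatEquiv (↥(maximalRealSubfield L)) (Fin n') (follandHermite (frameV L e₁ dV hdV hdV0 (lineW L (TW (Fp L) a')) (complexConj_lineW L (TW (Fp L) a'))
                (lineW_ne_zero L (TW (Fp L) a') (isUnit_det_TW (Fp L) a'))) β ⊗ₜ[ℂ] Φf)) (charCM ξ) μ 2) ≠ 0 →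
          ∀ Q : ContRepresentation.ClosedSubrep ((adelicGroupData (↥(maximalRealSubfield L)) L (IsCMField.complexConj L) 2 H).rightRegular μ),
            MemLp.toLp _ (memLp_toQuotFun_lineThetaLift L 2 H e₁ dV hdV hdV0 ιA hT lam hlam a' hρ μW
            (piSchwartzBruhatEquiv (↥(maximalRealSubfield L)) (Fin n') (follandHermite (frameV L e₁ dV hdV hdV0 (lineW L (TW (Fp L) a')) (complexConj_lineW L (TW (Fp L) a'))
                (lineW_ne_zero L (TW (Fp L) a') (isUnit_det_TW (Fp L) a'))) β ⊗ₜ[ℂ] Φf)) (charCM ξ) μ 2) ∈ Q →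
            ∀ (hρ' : HasThetaMajorants fun
          (p : ↥(UnitaryGroup.adelic (↥(maximalRealSubfield L)) L (IsCMField.complexConj L) 2 (Matrix.diagonal dV)) × ↥(UnitaryGroup.adelic (↥(maximalRealSubfield L)) L (IsCMField.complexConj L) 1 (JW (↥(maximalRealSubfield L)) L a'))) (Φ : piSchwartzBruhat (↥(maximalRealSubfield L)) (Fin n')) =>
            pairRep (↥(maximalRealSubfield L)) L (IsCMField.complexConj L) 2 1 e₁ (Matrix.diagonal dV) (JW (↥(maximalRealSubfield L)) L a')
              (chiSplittingLine L e₁ dV hdV hdV0 (toHeckeCharacter L lam) (isUnitary_toHeckeCharacter L lam)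
                ((isOscillatorChar_toHeckeCharacter_iff lam).mpr hlam) (TW (↥(maximalRealSubfield L)) a')
                (isUnit_det_TW (↥(maximalRealSubfield L)) a') (JW (↥(maximalRealSubfield L)) L a') (JW_eq (↥(maximalRealSubfield L)) L a'))
              p Φ)
            (μW' : Measure (↥(UnitaryGroup.adelic (↥(maximalRealSubfield L)) L (IsCMField.complexConj L) 1 (JW (↥(maximalRealSubfield L)) L a')) ⧸ (UnitaryGroup.toAdelic (↥(maximalRealSubfield L)) L (IsCMField.complexConj L) 1 (JW (↥(maximalRealSubfield L)) L a')).range)) [IsFiniteMeasure μW'] [SMulInvariantMeasure ↥(UnitaryGroup.adelic (↥(maximalRealSubfield L)) L (IsCMField.complexConj L) 1 (JW (↥(maximalRealSubfield L)) L a')) (↥(UnitaryGroup.adelic (↥(maximalRealSubfield L)) L (IsCMField.complexConj L) 1 (JW (↥(maximalRealSubfield L)) L a')) ⧸ (UnitaryGroup.toAdelic (↥(maximalRealSubfield L)) L (IsCMField.complexConj L) 1 (JW (↥(maximalRealSubfield L)) L a')).range) μW']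
            (Ψ : piSchwartzBruhat (↥(maximalRealSubfield L)) (Fin n')),
              MemLp.toLp _ (memLp_toQuotFun_lineThetaLift L 2 H e₁ dV hdV hdV0 ιA hT lam hlam a' hρ' μW'
            (Ψ) (charCM ξ) μ 2) ∈ Q

/-! ## §2 (Gα-C∞) `ArchLadder` and (Gα-Cf) `FinGeneration` -/

/-- **(Gα-C∞) `ArchLadder`** — ARCHIMEDEAN GENERATION through a closed invariant subspace, in class currency, over LITERALLY the `ThetaSlice₂` frames:
if the Hermite-slice class `w = [θ^{μ_W}_{h_β ⊗ Φ_f}]` is non-zero and lies in a closed `R`-invariant `Q`, then EVERY Hermite-slice class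
`[θ^{μ_W}_{h_β′ ⊗ Φ_f}]` (same `Φ_f`, any torus weight `β′`) lies in `Q`.  Intended proof: (a) a `β′` whose `U(W)_∞`-weight (the central `T_∞`-weight;
`U(W)` acts on `W ⊗ V = V` as the centre of `U(V)`) differs from that of `β` gives the ZERO class — ★ `toLp_lineThetaLift_pairRep_one_charCM` at an archimedean
`h ∈ U(W)(L⁺ ⊗ ℝ)` with `χ_{β′}(h) ≠ χ_β(h) = ξ_∞(h)`; (b) for `β′` of the same weight, a finite chain `β = β₀, …, β_m = β′` of archimedean elements
`u_i ∈ U(V)(L_{w})` with non-zero Hermite coefficient `⟨ω_w(u_i) h_{β_i}, h_{β_{i+1}}⟩ ≠ 0` (definite `w`: `U(2)` mixes the degree-`d` monomials of the Fock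
model; the place of `ι`: the `U(1,1)`-ladder [KashiwaraVergne1978, §6] ∕ [Folland1989, Thm. 4.37]); each step stays in `Q` because `R(ιA⁻¹(u_i))` and the torus
projector `P_{β_{i+1}}` preserve `Q` (★ `F0LD1ThetaSliceTorusProjector.charProj_restrict_mem_closedSubrep`), ★ `rightRegular_toLp_lineThetaLift`, arch elements
lie in the pinned image (★ `F0LD2ThetaKcInvariance.exists_mem_kerArchAt_pin_eq_adelicSingle`), and ★ `F0LD1ThetaClassTorusExtraction` §4 computes
`P_{β″} [θ_{φ ⊗ Φ_f}] = ⟨φ, h_{β″}⟩ • [θ_{h_{β″} ⊗ Φ_f}]`.  Equivalent (by reachability) to the IRREDUCIBILITY of the `ξ_∞`-isotypic part of the archimedean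
Weil representation under `U(V)_∞` (compact dual-pair member [Howe1989, §3]; [KashiwaraVergne1978]).  Why it might fail: only through a slip in the
weight bookkeeping at the place of `ι` (signature `(1,1)`: the `U(W)`-weight of `h_{(n₁,n₂)}` is `n₁ − n₂` up to the splitting shift, not `n₁ + n₂`).
ORGAN-GRADE L. (KashiwaraVergne1978, §6) (Folland1989, §4.4 Thm. 4.37) (Howe1989, §3) -/
def ArchLadder : Prop :=
  ∀ (L : Type) [Field L] [NumberField L] [IsCMField L] (ι : L →+* ℂ) (H : Matrix (Fin 2) (Fin 2) L)
      (dV : Fin 2 → L) (hdV : ∀ i, IsCMField.complexConj L (dV i) = dV i) (hdV0 : ∀ i, dV i ≠ 0)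
      (t : L) (ht : t ≠ 0) (g : GL (Fin 2) L)
      (hg : formCongr ((IsCMField.complexConj L : L ≃ₐ[↥(maximalRealSubfield L)] L) : L →+* L) g (t • H) = Matrix.diagonal dV),
      (∃ T : GL (Fin 2) ℂ, formCongr (starRingEnd ℂ) T ((Matrix.diagonal dV).map ι) = Matrix.diagonal ![(1 : ℂ), -1]) →
      ∀ (hdef : ∀ τ' : L →+* ℂ, InfinitePlace.mk τ' ≠ InfinitePlace.mk ι → ((Matrix.diagonal dV).map τ').PosDef)
        (hdeg : 4 ≤ Module.finrank ℚ L)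
        (μ : Measure (adelicGroupData (↥(maximalRealSubfield L)) L (IsCMField.complexConj L) 2 H).automorphicQuotient)
        [(adelicGroupData (↥(maximalRealSubfield L)) L (IsCMField.complexConj L) 2 H).IsAutomorphicMeasure μ]
        {n' : ℕ} (e₁ : Fin 2 × Fin 1 ≃ Fin n')
        (lam : Literature.NumberTheory.Automorphic.IdeleClassGroup L →ₜ* Circle) (hlam : IsConjugateSymplectic L lam), HasWeight L lam 1 →
      ∀ (ιA : (adelicGroupData (↥(maximalRealSubfield L)) L (IsCMField.complexConj L) 2 H).Adelic →*
          ↥(UnitaryGroup.adelic (↥(maximalRealSubfield L)) L (IsCMField.complexConj L) 2 (Matrix.diagonal dV)))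
        (hιA : ∀ k, ((ιA k : ↥(UnitaryGroup.adelic (↥(maximalRealSubfield L)) L (IsCMField.complexConj L) 2 (Matrix.diagonal dV))) :
              GL (Fin 2) (AdeleRing (𝓞 L) L)) =
            (toAdeleGL L g)⁻¹ * adelicVal (↥(maximalRealSubfield L)) L (IsCMField.complexConj L) 2 H k * toAdeleGL L g)
        [CompactSpace (↥(UnitaryGroup.adelic (↥(maximalRealSubfield L)) L (IsCMField.complexConj L) 2 (Matrix.diagonal dV)) ⧸
          (UnitaryGroup.toAdelic (↥(maximalRealSubfield L)) L (IsCMField.complexConj L) 2 (Matrix.diagonal dV)).range)]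
        (a' : (↥(maximalRealSubfield L))ˣ)
        (ξ : haveI := normal_range_toAdelic_JW L a'
          PontryaginDual (↥(UnitaryGroup.adelic (↥(maximalRealSubfield L)) L (IsCMField.complexConj L) 1 (JW (↥(maximalRealSubfield L)) L a')) ⧸ (UnitaryGroup.toAdelic (↥(maximalRealSubfield L)) L (IsCMField.complexConj L) 1 (JW (↥(maximalRealSubfield L)) L a')).range)),
        letI : MeasurableSpace (↥(UnitaryGroup.adelic (↥(maximalRealSubfield L)) L (IsCMField.complexConj L) 1 (JW (↥(maximalRealSubfield L)) L a')) ⧸ (UnitaryGroup.toAdelic (↥(maximalRealSubfield L)) L (IsCMField.complexConj L) 1 (JW (↥(maximalRealSubfield L)) L a')).range) := borel _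
        haveI := normal_range_toAdelic_JW L a'
        haveI : CompactSpace (adelicGroupData (↥(maximalRealSubfield L)) L (IsCMField.complexConj L) 2 H).automorphicQuotient :=
          (UnitaryGroup.exists_infinitePlace_ne L hdeg ι).elim fun τ hτ =>
            UnitaryGroup.compactSpace_adelicGroupData_automorphicQuotient L 2 H
              (UnitaryGroup.anisotropic_of_formCongr_smul_eq_of_posDef L 2 H dV t ht g hg τ (hdef τ hτ))
        haveI hT : Continuous ιA ∧ ∀ ⦃γ : (adelicGroupData (↥(maximalRealSubfield L)) L (IsCMField.complexConj L) 2 H).Adelic⦄,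
            γ ∈ (UnitaryGroup.toAdelic (↥(maximalRealSubfield L)) L (IsCMField.complexConj L) 2 H).range →
              ιA γ ∈ (UnitaryGroup.toAdelic (↥(maximalRealSubfield L)) L (IsCMField.complexConj L) 2 (Matrix.diagonal dV)).range :=
          ⟨continuous_of_pin L 2 H dV g ιA hιA, fun _ hγ => mem_range_toAdelic_of_pin L 2 H dV t ht g hg ιA hιA hγ⟩
        ∀ (hρ : HasThetaMajorants fun
          (p : ↥(UnitaryGroup.adelic (↥(maximalRealSubfield L)) L (IsCMField.complexConj L) 2 (Matrix.diagonal dV)) × ↥(UnitaryGroup.adelic (↥(maximalRealSubfield L)) L (IsCMField.complexConj L) 1 (JW (↥(maximalRealSubfield L)) L a'))) (Φ : piSchwartzBruhat (↥(maximalRealSubfield L)) (Fin n')) =>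
            pairRep (↥(maximalRealSubfield L)) L (IsCMField.complexConj L) 2 1 e₁ (Matrix.diagonal dV) (JW (↥(maximalRealSubfield L)) L a')
              (chiSplittingLine L e₁ dV hdV hdV0 (toHeckeCharacter L lam) (isUnitary_toHeckeCharacter L lam)
                ((isOscillatorChar_toHeckeCharacter_iff lam).mpr hlam) (TW (↥(maximalRealSubfield L)) a')
                (isUnit_det_TW (↥(maximalRealSubfield L)) a') (JW (↥(maximalRealSubfield L)) L a') (JW_eq (↥(maximalRealSubfield L)) L a'))
              p Φ)
        (μW : Measure (↥(UnitaryGroup.adelic (↥(maximalRealSubfield L)) L (IsCMField.complexConj L) 1 (JW (↥(maximalRealSubfield L)) L a')) ⧸ (UnitaryGroup.toAdelic (↥(maximalRealSubfield L)) L (IsCMField.complexConj L) 1 (JW (↥(maximalRealSubfield L)) L a')).range)) [IsFiniteMeasure μW] [SMulInvariantMeasure ↥(UnitaryGroup.adelic (↥(maximalRealSubfield L)) L (IsCMField.complexConj L) 1 (JW (↥(maximalRealSubfield L)) L a')) (↥(UnitaryGroup.adelic (↥(maximalRealSubfield L)) L (IsCMField.complexConj L) 1 (JW (↥(maximalRealSubfield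 L)) L a')) ⧸ (UnitaryGroup.toAdelic (↥(maximalRealSubfield L)) L (IsCMField.complexConj L) 1 (JW (↥(maximalRealSubfield L)) L a')).range) μW]
        (β : ((Fin n' × {v : InfinitePlace (↥(maximalRealSubfield L)) // v.IsReal}) →₀ ℕ)) (Φf : FinSB (↥(maximalRealSubfield L)) (Fin n')),
          MemLp.toLp _ (memLp_toQuotFun_lineThetaLift L 2 H e₁ dV hdV hdV0 ιA hT lam hlam a' hρ μW
            (piSchwartzBruhatEquiv (↥(maximalRealSubfield L)) (Fin n') (follandHermite (frameV L e₁ dV hdV hdV0 (lineW L (TW (Fp L) a')) (complexConj_lineW L (TW (Fp L) a'))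
                (lineW_ne_zero L (TW (Fp L) a') (isUnit_det_TW (Fp L) a'))) β ⊗ₜ[ℂ] Φf)) (charCM ξ) μ 2) ≠ 0 →
          ∀ Q : ContRepresentation.ClosedSubrep ((adelicGroupData (↥(maximalRealSubfield L)) L (IsCMField.complexConj L) 2 H).rightRegular μ),
            MemLp.toLp _ (memLp_toQuotFun_lineThetaLift L 2 H e₁ dV hdV hdV0 ιA hT lam hlam a' hρ μW
            (piSchwartzBruhatEquiv (↥(maximalRealSubfield L)) (Fin n') (follandHermite (frameV L e₁ dV hdV hdV0 (lineW L (TW (Fp L) a')) (complexConj_lineW L (TW (Fp L) a'))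
                (lineW_ne_zero L (TW (Fp L) a') (isUnit_det_TW (Fp L) a'))) β ⊗ₜ[ℂ] Φf)) (charCM ξ) μ 2) ∈ Q →
            ∀ β' : ((Fin n' × {v : InfinitePlace (↥(maximalRealSubfield L)) // v.IsReal}) →₀ ℕ),
              MemLp.toLp _ (memLp_toQuotFun_lineThetaLift L 2 H e₁ dV hdV hdV0 ιA hT lam hlam a' hρ μW
            (piSchwartzBruhatEquiv (↥(maximalRealSubfield L)) (Fin n') (follandHermite (frameV L e₁ dV hdV hdV0 (lineW L (TW (Fp L) a')) (complexConj_lineW L (TW (Fp L) a'))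
                (lineW_ne_zero L (TW (Fp L) a') (isUnit_det_TW (Fp L) a'))) β' ⊗ₜ[ℂ] Φf)) (charCM ξ) μ 2) ∈ Q


/-- **(Gα-Cf) `FinGeneration`** — FINITE-ADELIC GENERATION through a closed invariant subspace, in class currency, over LITERALLY the `ThetaSlice₂` frames:
if `[θ^{μ_W}_{h_β ⊗ Φ_f}] ≠ 0` (so `Φ_f` is NOT in the `(U(W)(𝔸_f), ξ_f)`-coinvariant kernel `N_{ξ,f}`) and `[θ^{μ_W}_{φ ⊗ Φ_f}] ∈ Q` for a closed
`R`-invariant `Q` and an archimedean `φ`, then `[θ^{μ_W}_{φ ⊗ Φ_f′}] ∈ Q` for EVERY `Φ_f′`.  Intended proof: `M := {Φ_f′ : [θ_{φ ⊗ Φ_f′}] ∈ Q}` is a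
`ℂ`-submodule (★ `toLp_lineThetaLift_tensor_add ∕ _smul`), stable under `ω_f(U(V)(𝔸_f))` (★ `F0LD1ThetaClassFinEquivariancePin` + invariance of `Q`),
contains `N_{ξ,f}` (★ `toLp_lineThetaLift_pairRep_one_charCM` at `h = (1, u_f)` + ★ `pairRep_finPairToAdelic_piSBReindex_tmul`) and `Φ_f ∉ N_{ξ,f}`; and
the LOCAL ALGEBRA (C_f-core): the big theta `Θ_f(ξ_f) = FinSB ∕ N_{ξ,f}` is an IRREDUCIBLE `U(V)(𝔸_f)`-module — restricted tensor product
([Flath1979, Thm. 2]; coinvariants commute with `⊗′`) of the local big thetas `Θ_v(ξ_v)`, irreducible at non-split `v` (compact member `U(1)(L⁺_v)`: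
★ `mvw_IV4_rankOne_irreducibleOrZero_holds`, [MoeglinVignerasWaldspurger1987, Chap. 3 IV.4]) and at split `v` (type II pair `(GL₁, GL₂)`: `Θ_v(ξ_v)` is the
unitary principal series of `GL₂(L⁺_v)` attached to `ξ_v`, irreducible since `ξ_v` is unitary; the `δ₀`-jet dies in unitary coinvariants [Minguez2008, Thm. 1]).
Why it might fail: at a split place the normalisation of the `GL₁`-action (`|a|^{±1}` twist) must be checked to kill the jet at `0` for UNITARY `ξ_v` —
if it survived, `Θ_v(ξ_v)` would have length 2 and `M` could be the proper submodule.  ORGAN-GRADE L–XL (Literature side).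
(MoeglinVignerasWaldspurger1987, Chap. 3 IV.4) (Flath1979, Thm. 2) (Minguez2008, Thm. 1) (GelbartRogawski1991, §3.2) -/
def FinGeneration : Prop :=
  ∀ (L : Type) [Field L] [NumberField L] [IsCMField L] (ι : L →+* ℂ) (H : Matrix (Fin 2) (Fin 2) L)
      (dV : Fin 2 → L) (hdV : ∀ i, IsCMField.complexConj L (dV i) = dV i) (hdV0 : ∀ i, dV i ≠ 0)
      (t : L) (ht : t ≠ 0) (g : GL (Fin 2) L)
      (hg : formCongr ((IsCMField.complexConj L : L ≃ₐ[↥(maximalRealSubfield L)] L) : L →+* L) g (t • H) = Matrix.diagonal dV),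
      (∃ T : GL (Fin 2) ℂ, formCongr (starRingEnd ℂ) T ((Matrix.diagonal dV).map ι) = Matrix.diagonal ![(1 : ℂ), -1]) →
      ∀ (hdef : ∀ τ' : L →+* ℂ, InfinitePlace.mk τ' ≠ InfinitePlace.mk ι → ((Matrix.diagonal dV).map τ').PosDef)
        (hdeg : 4 ≤ Module.finrank ℚ L)
        (μ : Measure (adelicGroupData (↥(maximalRealSubfield L)) L (IsCMField.complexConj L) 2 H).automorphicQuotient)
        [(adelicGroupData (↥(maximalRealSubfield L)) L (IsCMField.complexConj L) 2 H).IsAutomorphicMeasure μ]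
        {n' : ℕ} (e₁ : Fin 2 × Fin 1 ≃ Fin n')
        (lam : Literature.NumberTheory.Automorphic.IdeleClassGroup L →ₜ* Circle) (hlam : IsConjugateSymplectic L lam), HasWeight L lam 1 →
      ∀ (ιA : (adelicGroupData (↥(maximalRealSubfield L)) L (IsCMField.complexConj L) 2 H).Adelic →*
          ↥(UnitaryGroup.adelic (↥(maximalRealSubfield L)) L (IsCMField.complexConj L) 2 (Matrix.diagonal dV)))
        (hιA : ∀ k, ((ιA k : ↥(UnitaryGroup.adelic (↥(maximalRealSubfield L)) L (IsCMField.complexConj L) 2 (Matrix.diagonal dV))) :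
              GL (Fin 2) (AdeleRing (𝓞 L) L)) =
            (toAdeleGL L g)⁻¹ * adelicVal (↥(maximalRealSubfield L)) L (IsCMField.complexConj L) 2 H k * toAdeleGL L g)
        [CompactSpace (↥(UnitaryGroup.adelic (↥(maximalRealSubfield L)) L (IsCMField.complexConj L) 2 (Matrix.diagonal dV)) ⧸
          (UnitaryGroup.toAdelic (↥(maximalRealSubfield L)) L (IsCMField.complexConj L) 2 (Matrix.diagonal dV)).range)]
        (a' : (↥(maximalRealSubfield L))ˣ)
        (ξ : haveI := normal_range_toAdelic_JW L a'
          PontryaginDual (↥(UnitaryGroup.adelic (↥(maximalRealSubfield L)) L (IsCMField.complexConj L) 1 (JW (↥(maximalRealSubfield L)) L a')) ⧸ (UnitaryGroup.toAdelic (↥(maximalRealSubfield L)) L (IsCMField.complexConj L) 1 (JW (↥(maximalRealSubfield L)) L a')).range)),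
        letI : MeasurableSpace (↥(UnitaryGroup.adelic (↥(maximalRealSubfield L)) L (IsCMField.complexConj L) 1 (JW (↥(maximalRealSubfield L)) L a')) ⧸ (UnitaryGroup.toAdelic (↥(maximalRealSubfield L)) L (IsCMField.complexConj L) 1 (JW (↥(maximalRealSubfield L)) L a')).range) := borel _
        haveI := normal_range_toAdelic_JW L a'
        haveI : CompactSpace (adelicGroupData (↥(maximalRealSubfield L)) L (IsCMField.complexConj L) 2 H).automorphicQuotient :=
          (UnitaryGroup.exists_infinitePlace_ne L hdeg ι).elim fun τ hτ =>
            UnitaryGroup.compactSpace_adelicGroupData_automorphicQuotient L 2 H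
              (UnitaryGroup.anisotropic_of_formCongr_smul_eq_of_posDef L 2 H dV t ht g hg τ (hdef τ hτ))
        haveI hT : Continuous ιA ∧ ∀ ⦃γ : (adelicGroupData (↥(maximalRealSubfield L)) L (IsCMField.complexConj L) 2 H).Adelic⦄,
            γ ∈ (UnitaryGroup.toAdelic (↥(maximalRealSubfield L)) L (IsCMField.complexConj L) 2 H).range →
              ιA γ ∈ (UnitaryGroup.toAdelic (↥(maximalRealSubfield L)) L (IsCMField.complexConj L) 2 (Matrix.diagonal dV)).range :=
          ⟨continuous_of_pin L 2 H dV g ιA hιA, fun _ hγ => mem_range_toAdelic_of_pin L 2 H dV t ht g hg ιA hιA hγ⟩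
        ∀ (hρ : HasThetaMajorants fun
          (p : ↥(UnitaryGroup.adelic (↥(maximalRealSubfield L)) L (IsCMField.complexConj L) 2 (Matrix.diagonal dV)) × ↥(UnitaryGroup.adelic (↥(maximalRealSubfield L)) L (IsCMField.complexConj L) 1 (JW (↥(maximalRealSubfield L)) L a'))) (Φ : piSchwartzBruhat (↥(maximalRealSubfield L)) (Fin n')) =>
            pairRep (↥(maximalRealSubfield L)) L (IsCMField.complexConj L) 2 1 e₁ (Matrix.diagonal dV) (JW (↥(maximalRealSubfield L)) L a')
              (chiSplittingLine L e₁ dV hdV hdV0 (toHeckeCharacter L lam) (isUnitary_toHeckeCharacter L lam)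
                ((isOscillatorChar_toHeckeCharacter_iff lam).mpr hlam) (TW (↥(maximalRealSubfield L)) a')
                (isUnit_det_TW (↥(maximalRealSubfield L)) a') (JW (↥(maximalRealSubfield L)) L a') (JW_eq (↥(maximalRealSubfield L)) L a'))
              p Φ)
        (μW : Measure (↥(UnitaryGroup.adelic (↥(maximalRealSubfield L)) L (IsCMField.complexConj L) 1 (JW (↥(maximalRealSubfield L)) L a')) ⧸ (UnitaryGroup.toAdelic (↥(maximalRealSubfield L)) L (IsCMField.complexConj L) 1 (JW (↥(maximalRealSubfield L)) L a')).range)) [IsFiniteMeasure μW] [SMulInvariantMeasure ↥(UnitaryGroup.adelic (↥(maximalRealSubfield L)) L (IsCMField.complexConj L) 1 (JW (↥(maximalRealSubfield L)) L a')) (↥(UnitaryGroup.adelic (↥(maximalRealSubfield L)) L (IsCMField.complexConj L) 1 (JW (↥(maximalRealSubfield L)) L a')) ⧸ (UnitaryGroup.toAdelic (↥(maximalRealSubfield L)) L (IsCMField.complexConj L) 1 (JW (↥(maximalRealSubfield L)) L a')).range) μW]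
        (β : ((Fin n' × {v : InfinitePlace (↥(maximalRealSubfield L)) // v.IsReal}) →₀ ℕ)) (Φf : FinSB (↥(maximalRealSubfield L)) (Fin n')),
          MemLp.toLp _ (memLp_toQuotFun_lineThetaLift L 2 H e₁ dV hdV hdV0 ιA hT lam hlam a' hρ μW
            (piSchwartzBruhatEquiv (↥(maximalRealSubfield L)) (Fin n') (follandHermite (frameV L e₁ dV hdV hdV0 (lineW L (TW (Fp L) a')) (complexConj_lineW L (TW (Fp L) a'))
                (lineW_ne_zero L (TW (Fp L) a') (isUnit_det_TW (Fp L) a'))) β ⊗ₜ[ℂ] Φf)) (charCM ξ) μ 2) ≠ 0 →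
          ∀ (Q : ContRepresentation.ClosedSubrep ((adelicGroupData (↥(maximalRealSubfield L)) L (IsCMField.complexConj L) 2 H).rightRegular μ))
            (φ : 𝓢((Fin n' → mixedEmbedding.mixedSpace ↥(maximalRealSubfield L)), ℂ)),
            MemLp.toLp _ (memLp_toQuotFun_lineThetaLift L 2 H e₁ dV hdV hdV0 ιA hT lam hlam a' hρ μW
            (piSchwartzBruhatEquiv (↥(maximalRealSubfield L)) (Fin n') (φ ⊗ₜ[ℂ] Φf)) (charCM ξ) μ 2) ∈ Q →
            ∀ Φf' : FinSB (↥(maximalRealSubfield L)) (Fin n'),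
              MemLp.toLp _ (memLp_toQuotFun_lineThetaLift L 2 H e₁ dV hdV hdV0 ιA hT lam hlam a' hρ μW
            (piSchwartzBruhatEquiv (↥(maximalRealSubfield L)) (Fin n') (φ ⊗ₜ[ℂ] Φf')) (charCM ξ) μ 2) ∈ Q

end Summit.HodgeConjecture.HodgeConjecture.Cruxes.HLiu418.F0LD1ThetaDichotomyOfBricks

end
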